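import Summits.MatrixMultiplication.MatrixMultiplication.Theorems.SoloBlindMassCalculus

/-!
# Conjecture E at corank one, in every rank (and over every abelian group)

Sub-programme (K₃) / Conjecture E (K3.29, the type-presence method, first rung in the kernel).
For `h : ι → G` and a target `τ` the Kraft mass is `E(τ; S) = ∑_{T ⊆ S, ∑_T h = τ} 2^{-|T|}`
(`soloBlindMass`); CONJECTURE E asserts `E(τ; S) ≤ 1/2` whenever `h` is zero-sum free on `S` and `τ` is H-good
(`∑_T h ≠ τ + τ` for all `T ⊆ S`).

A finite set `B` is SUM-DISTINCT for `h` when distinct subsets of `B` have distinct `h`-sums — e.g. (the image of)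
a basis of a vector space (`soloBlind_sumDistinct_of_linearIndependent`).  The CORANK of `S ⊇ B` is `|S \ B|`.

* `soloBlind_conjE_corank_one` — CONJECTURE E AT CORANK ONE: if `B` is sum-distinct, `p ∉ B`, `h` is zero-sum
  free on `S = B ∪ {p}` and `τ` is H-good on `S`, then `E(τ; S) ≤ 1/2`.  This holds in EVERY rank `|B|` and over
  EVERY abelian group (no exponent hypothesis).  Proof: by the deletion identity
  `E(τ; S) = K(τ; B) + K(τ - h p; B) / 2` (`soloBlind_mass_erase`); each of the two masses on the sum-distinct `B`
  has at most one representation (`soloBlind_repAll_card_le_one_of_sumDistinct`), hence is `0` or `2^{-a}`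
  (`soloBlind_mass_le_pow_of_card_le_one`); and when both are present the value-stratum rigidity
  (`soloBlind_repAll_eq_singleton_of_value`: an element of value `τ` is the ONLY representation of an H-good `τ`)
  forces `a ≥ 2` for `τ` (a singleton `{q}` would exclude the representation `A' ∪ {p}`) and `a ≥ 1` for `τ - h p`
  (the empty representation means `h p = τ`, excluding the representation inside `B`), so
  `E ≤ 1/4 + 1/4`.
* `soloBlind_sumDistinct_of_linearIndependent` — a family that is linearly independent on `B` (elementary form:
  `∑_{i ∈ B} g i • h i = 0 → g = 0` on `B`) over a nontrivial ring is sum-distinct on `B`; with it,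
  `soloBlind_conjE_basis_add_one`: Conjecture E for `S` = (a linearly independent set) ∪ {one more element}, i.e.
  for every zero-sum-free `S` with `|S| ≤ rank S + 1`, in every rank.

(The pen/computer analysis K3.29 proves the same for corank `≤ 3` by a finite search over coordinate types; corank
one is the case with a two-line certificate, recorded here.)
-/

namespace Summit.MatrixMultiplication.MatrixMultiplication.Theorems

open Finset

universe u

variable {ι : Type*} [DecidableEq ι]
variable {G : Type u} [AddCommGroup G] [DecidableEq G]

omit [DecidableEq ι] in
/-- A mass with at most one representation, all of whose representations have at least `n` elements, is at most
`2^{-n}`. -/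
theorem soloBlind_mass_le_pow_of_card_le_one (h : ι → G) (B : Finset ι) (τ : G) (n : ℕ)
    (hR : (soloBlindSeqRepAll h B τ).card ≤ 1) (hn : ∀ T ∈ soloBlindSeqRepAll h B τ, n ≤ T.card) :
    soloBlindMass h B τ ≤ (1 / 2 : ℚ) ^ n := by
  rw [soloBlindMass]
  calc ∑ T ∈ soloBlindSeqRepAll h B τ, (1 / 2 : ℚ) ^ T.card
      ≤ ∑ T ∈ soloBlindSeqRepAll h B τ, (1 / 2 : ℚ) ^ n :=
        Finset.sum_le_sum (fun T hT => pow_le_pow_of_le_one (by norm_num) (by norm_num) (hn T hT))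
    _ = ((soloBlindSeqRepAll h B τ).card : ℚ) * (1 / 2 : ℚ) ^ n := by
        rw [Finset.sum_const, nsmul_eq_mul]
    _ ≤ 1 * (1 / 2 : ℚ) ^ n := by
        apply mul_le_mul_of_nonneg_right _ (by positivity)
        exact_mod_cast hR
    _ = (1 / 2 : ℚ) ^ n := one_mul _

omit [DecidableEq ι] in
/-- On a sum-distinct set every target has at most one representation. -/
theorem soloBlind_repAll_card_le_one_of_sumDistinct {h : ι → G} {B : Finset ι}
    (hdist : ∀ A ⊆ B, ∀ A' ⊆ B, ∑ i ∈ A, h i = ∑ i ∈ A', h i → A = A') (τ : G) :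
    (soloBlindSeqRepAll h B τ).card ≤ 1 := by
  refine Finset.card_le_one.mpr (fun A hA A' hA' => ?_)
  obtain ⟨hAB, hAs⟩ := soloBlind_mem_seqRepAll.mp hA
  obtain ⟨hA'B, hA's⟩ := soloBlind_mem_seqRepAll.mp hA'
  exact hdist A hAB A' hA'B (by rw [hAs, hA's])

/-- CONJECTURE E AT CORANK ONE (every rank, every abelian group): for a sum-distinct `B`, `p ∉ B`, `h` zero-sum
free on `B ∪ {p}` and `τ` H-good on `B ∪ {p}`, the Kraft mass satisfies `E(τ; B ∪ {p}) ≤ 1/2`. -/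
theorem soloBlind_conjE_corank_one {h : ι → G} {B : Finset ι} {p : ι} (hpB : p ∉ B)
    (hdist : ∀ A ⊆ B, ∀ A' ⊆ B, ∑ i ∈ A, h i = ∑ i ∈ A', h i → A = A')
    (zsf : ∀ T ⊆ insert p B, T.Nonempty → ∑ i ∈ T, h i ≠ 0) {τ : G}
    (hgood : ∀ T ⊆ insert p B, ∑ i ∈ T, h i ≠ τ + τ) :
    soloBlindMass h (insert p B) τ ≤ 1 / 2 := by
  have hpS : p ∈ insert p B := Finset.mem_insert_self p B
  have hBS : B ⊆ insert p B := Finset.subset_insert p B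
  rw [soloBlind_mass_erase h hpS τ, Finset.erase_insert hpB]
  have hR1 : (soloBlindSeqRepAll h B τ).card ≤ 1 := soloBlind_repAll_card_le_one_of_sumDistinct hdist τ
  have hR'1 : (soloBlindSeqRepAll h B (τ - h p)).card ≤ 1 :=
    soloBlind_repAll_card_le_one_of_sumDistinct hdist (τ - h p)
  -- representations inside `B` are representations in `S`; those of `τ - h p` lift by adding `p`
  have liftR : ∀ T ∈ soloBlindSeqRepAll h B τ, T ∈ soloBlindSeqRepAll h (insert p B) τ := by
    intro T hT
    obtain ⟨hTB, hs⟩ := soloBlind_mem_seqRepAll.mp hT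
    exact soloBlind_mem_seqRepAll.mpr ⟨hTB.trans hBS, hs⟩
  have liftR' : ∀ T ∈ soloBlindSeqRepAll h B (τ - h p),
      insert p T ∈ soloBlindSeqRepAll h (insert p B) τ := by
    intro T hT
    obtain ⟨hTB, hs⟩ := soloBlind_mem_seqRepAll.mp hT
    have hpT : p ∉ T := fun hpT => hpB (hTB hpT)
    refine soloBlind_mem_seqRepAll.mpr ⟨Finset.insert_subset_insert p hTB, ?_⟩
    rw [Finset.sum_insert hpT, hs, add_sub_cancel]
  have hgoodB : ∀ T ⊆ B, ∑ i ∈ T, h i ≠ τ + τ := fun T hT => hgood T (hT.trans hBS)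
  have hRpos : ∀ T ∈ soloBlindSeqRepAll h B τ, 1 ≤ T.card := fun T hT =>
    Nat.one_le_iff_ne_zero.mpr (soloBlind_repAll_card_ne_zero hgoodB hT)
  by_cases hRne : (soloBlindSeqRepAll h B τ).Nonempty
  · obtain ⟨A, hA⟩ := hRne
    by_cases hR'ne : (soloBlindSeqRepAll h B (τ - h p)).Nonempty
    · obtain ⟨A', hA'⟩ := hR'ne
      -- both present: value-stratum rigidity forces `|A| ≥ 2` and `|A'| ≥ 1`
      have hR2 : ∀ T ∈ soloBlindSeqRepAll h B τ, 2 ≤ T.card := by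
        intro T hT
        have h1 := hRpos T hT
        by_contra hlt
        have hc1 : T.card = 1 := by omega
        obtain ⟨q, rfl⟩ := Finset.card_eq_one.mp hc1
        obtain ⟨hqB, hqs⟩ := soloBlind_mem_seqRepAll.mp hT
        rw [Finset.sum_singleton] at hqs
        have hq : q ∈ B := hqB (Finset.mem_singleton_self q)
        have honly := soloBlind_repAll_eq_singleton_of_value zsf hgood (hBS hq) hqs
        have hmem := liftR' A' hA'
        rw [honly, Finset.mem_singleton] at hmem
        have hpq : p ∈ ({q} : Finset ι) := hmem ▸ Finset.mem_insert_self p A'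
        rw [Finset.mem_singleton] at hpq
        exact hpB (hpq ▸ hq)
      have hR'pos : ∀ T ∈ soloBlindSeqRepAll h B (τ - h p), 1 ≤ T.card := by
        intro T hT
        rw [Nat.one_le_iff_ne_zero]
        intro h0
        rw [Finset.card_eq_zero] at h0
        obtain ⟨-, hs⟩ := soloBlind_mem_seqRepAll.mp hT
        rw [h0, Finset.sum_empty] at hs
        have hpτ : h p = τ := (sub_eq_zero.mp hs.symm).symm
        have honly := soloBlind_repAll_eq_singleton_of_value zsf hgood hpS hpτ
        have hmem := liftR A hA
        rw [honly, Finset.mem_singleton] at hmem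
        obtain ⟨hAB, -⟩ := soloBlind_mem_seqRepAll.mp hA
        have hpA : p ∈ A := hmem ▸ Finset.mem_singleton_self p
        exact hpB (hAB hpA)
      have e1 := soloBlind_mass_le_pow_of_card_le_one h B τ 2 hR1 hR2
      have e2 := soloBlind_mass_le_pow_of_card_le_one h B (τ - h p) 1 hR'1 hR'pos
      rw [pow_one] at e2
      have e1' : soloBlindMass h B τ ≤ 1 / 4 := by norm_num at e1; exact e1
      linarith
    · -- no representation of `τ - h p` inside `B`
      have hR'0 : soloBlindSeqRepAll h B (τ - h p) = ∅ := Finset.not_nonempty_iff_eq_empty.mp hR'ne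
      have e0 : soloBlindMass h B (τ - h p) = 0 := by
        rw [soloBlindMass, hR'0, Finset.sum_empty]
      have e1 := soloBlind_mass_le_pow_of_card_le_one h B τ 1 hR1 hRpos
      rw [pow_one] at e1
      rw [e0]
      linarith
  · -- no representation of `τ` inside `B`
    have hR0 : soloBlindSeqRepAll h B τ = ∅ := Finset.not_nonempty_iff_eq_empty.mp hRne
    have e0 : soloBlindMass h B τ = 0 := by rw [soloBlindMass, hR0, Finset.sum_empty]
    have e2 := soloBlind_mass_le_pow_of_card_le_one h B (τ - h p) 0 hR'1 (fun T _ => Nat.zero_le _)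
    rw [pow_zero] at e2
    rw [e0]
    linarith

section LinearIndependence

variable {R : Type*} [Ring R] [Nontrivial R] [Module R G]

omit [DecidableEq G] in
/-- A family that is linearly independent on `B` (elementary form) over a nontrivial ring is sum-distinct on `B`:
equal subset sums force equal subsets.  (A basis of an `𝔽₃`-space is the case in point.) -/
theorem soloBlind_sumDistinct_of_linearIndependent {h : ι → G} {B : Finset ι}
    (hli : ∀ g : ι → R, ∑ i ∈ B, g i • h i = 0 → ∀ i ∈ B, g i = 0) :
    ∀ A ⊆ B, ∀ A' ⊆ B, ∑ i ∈ A, h i = ∑ i ∈ A', h i → A = A' := by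
  intro A hAB A' hA'B hsum
  set g : ι → R := fun i => (if i ∈ A then (1 : R) else 0) - (if i ∈ A' then (1 : R) else 0) with hg
  have hlin : ∑ i ∈ B, g i • h i = 0 := by
    have e1 : ∑ i ∈ B, (if i ∈ A then (1 : R) else 0) • h i = ∑ i ∈ A, h i := by
      rw [show (∑ i ∈ B, (if i ∈ A then (1 : R) else 0) • h i) = ∑ i ∈ B, (if i ∈ A then h i else 0) from
        Finset.sum_congr rfl (fun i _ => by split_ifs <;> simp), Finset.sum_ite_mem,
        Finset.inter_eq_right.mpr hAB]
    have e2 : ∑ i ∈ B, (if i ∈ A' then (1 : R) else 0) • h i = ∑ i ∈ A', h i := by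
      rw [show (∑ i ∈ B, (if i ∈ A' then (1 : R) else 0) • h i) = ∑ i ∈ B, (if i ∈ A' then h i else 0) from
        Finset.sum_congr rfl (fun i _ => by split_ifs <;> simp), Finset.sum_ite_mem,
        Finset.inter_eq_right.mpr hA'B]
    simp only [hg, sub_smul, Finset.sum_sub_distrib, e1, e2, hsum, sub_self]
  have hz := hli g hlin
  ext i
  by_cases hiB : i ∈ B
  · have hi := hz i hiB
    simp only [hg] at hi
    by_cases hiA : i ∈ A <;> by_cases hiA' : i ∈ A' <;> simp [hiA, hiA'] at hi ⊢
  · exact ⟨fun hiA => (hiB (hAB hiA)).elim, fun hiA' => (hiB (hA'B hiA')).elim⟩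

omit [DecidableEq G] in
/-- CONJECTURE E FOR `|S| ≤ rank S + 1`, EVERY RANK: if `h` is linearly independent on `B` (elementary form, over a
nontrivial ring acting on `G`), `p ∉ B`, `h` is zero-sum free on `B ∪ {p}` and `τ` is H-good there, then
`E(τ; B ∪ {p}) ≤ 1/2`. -/
theorem soloBlind_conjE_basis_add_one [DecidableEq G] {h : ι → G} {B : Finset ι} {p : ι} (hpB : p ∉ B)
    (hli : ∀ g : ι → R, ∑ i ∈ B, g i • h i = 0 → ∀ i ∈ B, g i = 0)
    (zsf : ∀ T ⊆ insert p B, T.Nonempty → ∑ i ∈ T, h i ≠ 0) {τ : G}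
    (hgood : ∀ T ⊆ insert p B, ∑ i ∈ T, h i ≠ τ + τ) :
    soloBlindMass h (insert p B) τ ≤ 1 / 2 :=
  soloBlind_conjE_corank_one hpB (soloBlind_sumDistinct_of_linearIndependent (R := R) hli) zsf hgood

end LinearIndependence

end Summit.MatrixMultiplication.MatrixMultiplication.Theorems
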